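import Summits.ResolutionOfSingularities.ResolutionOfSingularities.Theorems.PurelyInseparableDim4WinCertLeafTorusCore
import HarnessLib
import HarnessLib.Audit.Tags

/-!
# Purely inseparable fourfolds — FCert v3 with TORUS FLATS: rows `TRow` and the kernel-reducible checker `twinCertBL`
# [OURS · counted 0 · a certificate format for OUR frame v4, not about resolution]

Census cell «res-dim4-pi» (D-0157 DOOR 2), desk WORD #164 (b) «∀K RESIDUE»; seat res-rescue-typ-3 g10.  A row of the
torus format is an FCert-v3 row (✓ `…WinCertLeaf`/`…WinCertLeafStill`) plus TORUS FLATS `(φ, certs)`: a coordinate flat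
`φ = (j, b0, U)` of the chart (`b0 = 0` on `U`) with, for every support pattern `W ⊆ U`, an exponent certificate
`(W, d, m, l)`.  Clauses: `boxB`, `pthPowB`, **`torusPatternOKB`** (every surviving box exponent `k` of every term
`(e, c)` of the NORMALISED base child `normL c₀.L` satisfies `d·(e_u − k_u) = m_u + Σᵢ kᵢ l_{u,i}`), `oneOnK`, **`ltorusFlatOKB`** (for every
`W ⊆ U`: a passing certificate AND a later row presenting the 𝔽_p-point child `stepD q S j (b0 + 1_W) s`), `allFlats`
(torus flats count as flats for replies and covers), **`trowOKL`** (= `lrowOKLS` of ✓ `…WinCertLeafStill` with these two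
additions), `twinCertBL`, block form `twinCertBL2` / `twinCertBL_append_of`, and the Bool-to-Prop unpackings.
Soundness: `…WinCertLeafTorus`.  Nothing here proves resolution of singularities in dimension ≥ 4 / characteristic `p`;
F4-C(2,2) stays OPEN.  Counted 0; AI work, weaker than expert review.
bears_on: LADDER-RESOLUTION:D157-DOOR2 (res-dim4-pi · F4-C ∀K column · torus-flat checker).
Supports stmt-ResolutionOfSingularities-16155 (helper).
-/


set_option linter.dupNamespace false

noncomputable section
open MvPolynomial Finset
open scoped BigOperators
namespace Summit.ResolutionOfSingularities.ResolutionOfSingularities.Theorems.PIDim4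

namespace WinCertLeaf

open Literature.AlgebraicGeometry.Resolution
open Literature.AlgebraicGeometry.Resolution.Hauser2010
open Literature.AlgebraicGeometry.Resolution.CentreBlowup
open StepKit WinCertSound InScopeWinCert ScopeCover ScopeBlind WinCertAllFields FlatAbsorb WinCertFlat WinCertSubst
open TorusFlat

/-! ## 0. Rows with torus flats and the checker -/

section Checker

variable {k : Type} [Field k] [DecidableEq k]

variable {C : Type}

/-- A torus certificate for one support pattern: `(W, d, m, l)`. [folklore] -/
abbrev TCert : Type := Finset (Fin 4) × ℕ × (Fin 4 → ℤ) × (Fin 4 → Fin 4 → ℤ)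

/-- A TORUS FLAT: a coordinate flat with its per-pattern certificates. [folklore] -/
abbrev TFlat (k : Type) : Type := Flat k × List TCert

/-- A row of the torus format: an FCert-v3 row plus its torus flats. [folklore] -/
abbrev TRow (k : Type) (C : Type) : Type := LRow k C × List (TFlat k)

/-- The box of exponents below `e` on `W` and equal to `e` off `W`. [folklore] -/
def boxB (W : Finset (Fin 4)) (e : Fin 4 → ℕ) : Finset (Fin 4 → ℕ) :=
  Fintype.piFinset fun i => if i ∈ W then Finset.range (e i + 1) else {e i}

omit [Field k] [DecidableEq k] in
/-- Membership in the box. [folklore] -/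
theorem mem_boxB {W : Finset (Fin 4)} {e kk : Fin 4 → ℕ} :
    kk ∈ boxB W e ↔ (∀ i, kk i ≤ e i) ∧ (∀ i, i ∉ W → kk i = e i) := by
  unfold boxB
  rw [Fintype.mem_piFinset]
  constructor
  · intro h
    refine ⟨fun i => ?_, fun i hi => ?_⟩
    · have := h i
      split_ifs at this with hi
      · exact Nat.lt_succ_iff.mp (Finset.mem_range.mp this)
      · exact (Finset.mem_singleton.mp this).le
    · have := h i
      rw [if_neg hi, Finset.mem_singleton] at this
      exact this
  · rintro ⟨hle, heq⟩ i
    split_ifs with hi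
    · exact Finset.mem_range.mpr (Nat.lt_succ_iff.mpr (hle i))
    · exact Finset.mem_singleton.mpr (heq i hi)

/-- `k` is a `q`-th power exponent (deleted by cleaning). [folklore] -/
def pthPowB (q : ℕ) (kk : Fin 4 → ℕ) : Bool := decide (∀ i, q ∣ kk i)

omit [Field k] [DecidableEq k] in
/-- Transfer of `pthPowB`. [folklore] -/
theorem pthPowB_eq_true_iff (q : ℕ) (kk : Fin 4 → ℕ) : pthPowB q kk = true ↔ IsPthPowerExponent q (expo kk) := by
  unfold pthPowB
  rw [decide_eq_true_iff, isPthPowerExponent_iff]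
  simp only [expo_apply]

/-- **The torus pattern check** on a presented base child `L` for the support pattern `W` with certificate
`(d, m, l)`: `d ≥ 1` and every surviving box exponent of every term satisfies `d·(e_u − k_u) = m_u + Σᵢ kᵢ l_{u,i}`.
[folklore] -/
def torusPatternOKB (q : ℕ) (L : Terms 4 k) (W : Finset (Fin 4)) (d : ℕ) (m : Fin 4 → ℤ)
    (l : Fin 4 → Fin 4 → ℤ) : Bool :=
  decide (0 < d) &&
    decide (∀ t ∈ L, ∀ kk ∈ boxB W t.1, pthPowB q kk = false →
      ∀ u ∈ W, (d : ℤ) * ((t.1 u - kk u : ℕ) : ℤ) = m u + ∑ i, (kk i : ℤ) * l u i)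

/-- The indicator point of `W` over `k`. [folklore] -/
def oneOnK (W : Finset (Fin 4)) : Fin 4 → k := fun i => if i ∈ W then 1 else 0

variable [Fintype k]

/-- **The torus-flat clause**: the flat sits in a chart of the centre through a centre point, its base point vanishes
on the free coordinates, and for EVERY support pattern `W ⊆ U` a certificate passes the pattern check on the base child
and the 𝔽_p-point child at `b0 + 1_W` is presented by a later row. [folklore] -/
def ltorusFlatOKB (q : ℕ) (rest : LCert k C) (s : SData 4 k) (S : Finset (Fin 4)) (φ : Flat k)
    (certs : List TCert) : Bool :=
  decide (φ.j ∈ S) && decide (φ.b0 φ.j = 0) && decide (∀ u ∈ φ.U, φ.b0 u = 0) &&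
    decide (∀ W ∈ φ.U.powerset,
      (∃ c ∈ certs, c.1 = W ∧ torusPatternOKB q (normL (stepD q S φ.j φ.b0 s).L) W c.2.1 c.2.2.1 c.2.2.2 = true) ∧
      rest.any (fun r : LRow k C => (stepD q S φ.j (φ.b0 + oneOnK W) s).equivB r.1.1) = true)

/-- All flats of a torus row (ordinary ++ torus), for the reply and cover checks. [folklore] -/
def allFlats (row : TRow k C) : List (Flat k) := row.1.2.2.1 ++ row.2.map Prod.fst

/-- **The row check** of the torus format. [folklore] -/
def trowOKL (p q : ℕ) (leafOK : SData 4 k → Finset (Fin 4) → ILeaf k C → Bool) (rest : List (TRow k C))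
    (row : TRow k C) : Bool :=
  lblindOKS q row.1 || !(permB q Finset.univ row.1.1.1.L) ||
    (permB q row.1.1.2.1 row.1.1.1.L &&
      lrepliesOKB q (rest.map Prod.fst) row.1.1.1 row.1.1.2.1 (allFlats row) row.1.2.2.2 &&
      lflatsOKBS q (rest.map Prod.fst) row.1.1.1 row.1.1.2.1 row.1.2.2.1 &&
      decide (∀ ψ ∈ row.2, ltorusFlatOKB q (rest.map Prod.fst) row.1.1.1 row.1.1.2.1 ψ.1 ψ.2 = true) &&
      lleavesOKB leafOK row.1.1.1 row.1.1.2.1 row.1.2.2.2 &&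
      lcoversOKB p q row.1.1.1 row.1.1.2.1 row.1.2.1 (allFlats row) row.1.2.2.2)

/-- **The checker** (torus format). [folklore] -/
def twinCertBL (p q : ℕ) (leafOK : SData 4 k → Finset (Fin 4) → ILeaf k C → Bool) : List (TRow k C) → Bool
  | [] => true
  | row :: rest => trowOKL p q leafOK rest row && twinCertBL p q leafOK rest

/-- **Block form of the checker.** [folklore] -/
def twinCertBL2 (p q : ℕ) (leafOK : SData 4 k → Finset (Fin 4) → ILeaf k C → Bool) :
    List (TRow k C) → List (TRow k C) → Bool
  | [], _ => true
  | row :: A, B => trowOKL p q leafOK (A ++ B) row && twinCertBL2 p q leafOK A B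

/-- `twinCertBL (A ++ B)` splits into the block check of `A` over `B` and the check of `B`. [folklore] -/
theorem twinCertBL_append (p q : ℕ) (leafOK : SData 4 k → Finset (Fin 4) → ILeaf k C → Bool) :
    ∀ A B : List (TRow k C),
      twinCertBL p q leafOK (A ++ B) = (twinCertBL2 p q leafOK A B && twinCertBL p q leafOK B)
  | [], B => by simp [twinCertBL2]
  | row :: A, B => by
    rw [List.cons_append, show twinCertBL p q leafOK (row :: (A ++ B)) =
      (trowOKL p q leafOK (A ++ B) row && twinCertBL p q leafOK (A ++ B)) from rfl,
      show twinCertBL2 p q leafOK (row :: A) B = (trowOKL p q leafOK (A ++ B) row && twinCertBL2 p q leafOK A B)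
      from rfl, twinCertBL_append p q leafOK A B, Bool.and_assoc]

/-- Assembling a certificate check from a block check and the check of the tail. [folklore] -/
theorem twinCertBL_append_of (p q : ℕ) (leafOK : SData 4 k → Finset (Fin 4) → ILeaf k C → Bool)
    {A B : List (TRow k C)} (hA : twinCertBL2 p q leafOK A B = true) (hB : twinCertBL p q leafOK B = true) :
    twinCertBL p q leafOK (A ++ B) = true := by
  rw [twinCertBL_append, hA, hB, Bool.and_self]

omit [Field k] [DecidableEq k] [Fintype k] in
/-- Soundness of `torusPatternOKB`: the certificate identities, in the shape `clean_translate_eq_torus` wants.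
[folklore] -/
theorem cert_of_torusPatternOKB {q : ℕ} {L : Terms 4 k} {W : Finset (Fin 4)} {d : ℕ} {m : Fin 4 → ℤ}
    {l : Fin 4 → Fin 4 → ℤ} (h : torusPatternOKB q L W d m l = true) :
    0 < d ∧ ∀ t ∈ L, ∀ kk : Fin 4 → ℕ, (∀ i, kk i ≤ t.1 i) → (∀ i, i ∉ W → kk i = t.1 i) →
      ¬ IsPthPowerExponent q (expo kk) → ∀ u ∈ W, (d : ℤ) * ((t.1 u - kk u : ℕ) : ℤ) = m u + ∑ i, (kk i : ℤ) * l u i := by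
  unfold torusPatternOKB at h
  rw [Bool.and_eq_true, decide_eq_true_iff, decide_eq_true_iff] at h
  refine ⟨h.1, fun t ht kk hle heq hp => h.2 t ht kk (mem_boxB.mpr ⟨hle, heq⟩) ?_⟩
  rw [← Bool.not_eq_true, pthPowB_eq_true_iff]
  exact hp

omit [Fintype k] in
/-- Soundness of `ltorusFlatOKB`. [folklore] -/
theorem of_ltorusFlatOKB {q : ℕ} {rest : LCert k C} {s : SData 4 k} {S : Finset (Fin 4)} {φ : Flat k}
    {certs : List TCert} (h : ltorusFlatOKB q rest s S φ certs = true) :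
    φ.j ∈ S ∧ φ.b0 φ.j = 0 ∧ (∀ u ∈ φ.U, φ.b0 u = 0) ∧
      ∀ W, W ⊆ φ.U →
        (∃ c ∈ certs, c.1 = W ∧ torusPatternOKB q (normL (stepD q S φ.j φ.b0 s).L) W c.2.1 c.2.2.1 c.2.2.2 = true) ∧
        ∃ r ∈ rest, (stepD q S φ.j (φ.b0 + oneOnK W) s).toState = r.1.1.toState := by
  unfold ltorusFlatOKB at h
  rw [Bool.and_eq_true, Bool.and_eq_true, Bool.and_eq_true] at h
  obtain ⟨⟨⟨hj, hb⟩, hU⟩, hW⟩ := h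
  refine ⟨of_decide_eq_true hj, of_decide_eq_true hb, of_decide_eq_true hU, fun W hWU => ?_⟩
  obtain ⟨hc, hr⟩ := of_decide_eq_true hW W (Finset.mem_powerset.mpr hWU)
  refine ⟨hc, ?_⟩
  obtain ⟨r, hr, hrc⟩ := List.any_eq_true.mp hr
  exact ⟨r, hr, (toState_eq_iff _ r.1.1).mpr hrc⟩

end Checker

end WinCertLeaf

end Summit.ResolutionOfSingularities.ResolutionOfSingularities.Theorems.PIDim4

end
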